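import Literature.NumberTheory.Automorphic.HidaEngineBridge
import Mathlib.Algebra.CharP.Lemmas
import Mathlib.RingTheory.Finiteness.Ideal
import HarnessLib

/-!
# The diamond symbols act unipotently modulo `p` on the engine modules

Topic `NumberTheory/Automorphic`; namespaces `Literature.NumberTheory.Automorphic` (generic algebra),
`…BigHeckeGLn` (congruence tori) and `…BigHeckeGLn.TameLevel` (engine); theorems only (no named
fact, no `sorry`).

For Hida's control theorem at a dominant ordinary point the ideal `J = (p, X_{d_1} − 1, …, X_{d_m} − 1)`
of the symbol ring `O[Syms]` must act NILPOTENTLY on the level modules `E_n(j)` (nilpotent Nakayama,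
uniform generator bounds).  We prove it:

* `exists_neg_one_pow_prime_pow_add_one`, `sub_one_mem_radical_of_pow_sub_one_mem` — in a commutative
  ring, `p ∈ √A` and `x^{p^a} − 1 ∈ A` give `x − 1 ∈ √A`;
* `exists_pow_smul_top_eq_bot_of_le_radical`, `smul_top_characterModule_eq_bot` — a finitely
  generated `J ⊆ √Ann(M)` has `J^L M = 0`, and then `J^L M^∨ = 0`;
* `valued_pow_prime_sub_one_le`, **`pow_prime_pow_mem_torusBall`** — `u ∈ T_w(b)`, `b ≥ 1`, `w ∣ p`
  `⇒ u^{p^a} ∈ T_w(b + a)` (`(x^p − 1) = (x − 1)(1 + x + ⋯ + x^{p−1})`, the second factor `≡ p`);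
* **`engHecke_torusElement_pow_eq_one`** — `⟨d⟩^{p^a} = 1` on `H^j(X_{U(lv n)}, O/pⁿ)` for a torus
  datum `d` of depth `c₀ ≥ 1` and `c₀ + a ≥ lv n` (`levelTorus_eq_one_of_mem`);
* **`exists_pow_weightIdeal_smul_top_eq_bot`** — for torus data `d_i` of depth `c₀ ≥ 1` whose weight
  constants `N(u¹_{d})^{k−2}` are `1` in `O`, some power of `J = (p, X_{d_i} − 1)` kills the twisted
  level module `E_n(j)` and its character module.

[cite: Hida1994AIF, §3, proof of Thm 3.2] [cite: KhareThorne2017, §6.5, Lemma 6.17]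

## References

* H. Hida, Ann. Inst. Fourier 44 (1994), §3 (held). [Hida1994AIF]
* C. Khare, J. A. Thorne, Amer. J. Math. 139 (2017), §6.3–6.5 (arXiv:1409.7007, held). [KhareThorne2017]
-/

noncomputable section

open IsDedekindDomain MvPolynomial
open scoped NumberField

namespace Literature.NumberTheory.Automorphic

/-! ### Generic algebra: unipotence modulo a radical, nilpotent ideals on a module -/

/-- `(-1)^{p^a} + 1 ∈ (p)` for a prime `p`. [folklore] -/
theorem exists_neg_one_pow_prime_pow_add_one {R : Type*} [CommRing R] {p : ℕ} (hp : p.Prime) (a : ℕ) :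
    ∃ e : R, (-1 : R) ^ p ^ a + 1 = p * e := by
  rcases hp.eq_two_or_odd' with rfl | hodd
  · rcases Nat.eq_zero_or_pos a with rfl | ha
    · exact ⟨0, by norm_num⟩
    · refine ⟨1, ?_⟩
      have heven : Even (2 ^ a) := (Nat.even_pow' ha.ne').2 (by decide)
      rw [heven.neg_one_pow]
      norm_num
  · refine ⟨0, ?_⟩
    rw [(hodd.pow (n := a)).neg_one_pow, mul_zero, neg_add_cancel]

/-- **`p ∈ √A` and `x^{p^a} − 1 ∈ A` imply `x − 1 ∈ √A`** (binomial theorem modulo `p`). [folklore] -/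
theorem sub_one_mem_radical_of_pow_sub_one_mem {R : Type*} [CommRing R] {p : ℕ} (hp : p.Prime) (A : Ideal R)
    (hpA : (p : R) ∈ A.radical) {x : R} {a : ℕ} (hx : x ^ p ^ a - 1 ∈ A.radical) : x - 1 ∈ A.radical := by
  obtain ⟨r, hr⟩ := exists_add_pow_prime_pow_eq hp x (-1) a
  obtain ⟨e, he⟩ := exists_neg_one_pow_prime_pow_add_one (R := R) hp a
  have hpow : (x - 1) ^ p ^ a ∈ A.radical := by
    have hcalc : (x - 1) ^ p ^ a = (x ^ p ^ a - 1) + ((-1 : R) ^ p ^ a + 1) + p * x * (-1) * r := by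
      rw [sub_eq_add_neg, hr]; ring
    rw [hcalc, he]
    refine add_mem (add_mem hx (Ideal.mul_mem_right _ _ hpA)) ?_
    have h' : (p : R) * x * (-1) * r = (p : R) * (x * (-1) * r) := by ring
    rw [h']
    exact Ideal.mul_mem_right _ _ hpA
  rw [← Ideal.radical_idem]
  exact ⟨p ^ a, hpow⟩

/-- **A finitely generated ideal inside `√Ann(M)` has a power killing `M`.** [folklore] -/
theorem exists_pow_smul_top_eq_bot_of_le_radical {R M : Type*} [CommRing R] [AddCommGroup M] [Module R M]
    (J : Ideal R) (hJ : J.FG) (hle : J ≤ ((⊤ : Submodule R M).annihilator).radical) :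
    ∃ L : ℕ, J ^ L • (⊤ : Submodule R M) = ⊥ := by
  obtain ⟨L, hL⟩ := Ideal.exists_pow_le_of_le_radical_of_fg hle hJ
  refine ⟨L, eq_bot_iff.2 ?_⟩
  calc J ^ L • (⊤ : Submodule R M) ≤ (⊤ : Submodule R M).annihilator • ⊤ := Submodule.smul_mono_left hL
    _ = ⊥ := Submodule.annihilator_smul ⊤
    _ ≤ ⊥ := le_rfl

/-- An ideal killing `M` kills the character module `M^∨`. [folklore] -/
theorem smul_top_characterModule_eq_bot {R M : Type*} [CommRing R] [AddCommGroup M] [Module R M]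
    (I : Ideal R) (hI : I • (⊤ : Submodule R M) = ⊥) : I • (⊤ : Submodule R (CharacterModule M)) = ⊥ := by
  refine eq_bot_iff.2 (Submodule.smul_le.2 fun r hr φ _ => ?_)
  rw [Submodule.mem_bot]
  refine DFunLike.ext (F := CharacterModule M) _ _ fun m => ?_
  rw [CharacterModule.smul_apply]
  have hm : r • m ∈ I • (⊤ : Submodule R M) := Submodule.smul_mem_smul hr Submodule.mem_top
  rw [hI, Submodule.mem_bot] at hm
  rw [hm, map_zero]
  rfl

/-- Membership of an element's action in the annihilator of `⊤`. [folklore] -/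
theorem mem_annihilator_top_iff {R M : Type*} [CommRing R] [AddCommGroup M] [Module R M] (r : R) :
    r ∈ (⊤ : Submodule R M).annihilator ↔ ∀ m : M, r • m = 0 := by
  rw [Submodule.mem_annihilator]
  exact ⟨fun h m => h m Submodule.mem_top, fun h m _ => h m⟩

/-! ### `p`-th powers in the congruence tori -/

namespace BigHeckeGLn

variable {K : Type} [Field K] [NumberField K] {p : ℕ}

/-- `|p|_w ≤ |ϖ_w|` for `w ∣ p`. [folklore] -/
theorem valued_natCast_prime_le {w : HeightOneSpectrum (𝓞 K)} (hw : (p : 𝓞 K) ∈ w.asIdeal) :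
    Valued.v ((p : ℕ) : w.adicCompletion K) ≤ (WithZero.exp (-(1 : ℤ)) : WithZero (Multiplicative ℤ)) := by
  have h : ((p : ℕ) : w.adicCompletion K) = algebraMap K (w.adicCompletion K) ((p : 𝓞 K) : K) := by simp
  rw [h]
  change Valued.v ((((p : 𝓞 K) : K)) : w.adicCompletion K) ≤ _
  rw [HeightOneSpectrum.valuedAdicCompletion_eq_valuation', HeightOneSpectrum.valuation_of_algebraMap]
  have h1 : w.intValuation (p : 𝓞 K) ≤ WithZero.exp (-((1 : ℕ) : ℤ)) :=
    (w.intValuation_le_pow_iff_mem _ 1).2 (by rwa [pow_one])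
  rwa [Nat.cast_one] at h1

/-- **`|x^p − 1| ≤ |ϖ|^{b+1}` when `|x − 1| ≤ |ϖ|^b`, `b ≥ 1`, `|x| ≤ 1`, `w ∣ p`**: `x^p − 1 = (x − 1)(1 + ⋯ + x^{p−1})`
and the second factor is `≡ p` modulo `x − 1`. [folklore] -/
theorem valued_pow_prime_sub_one_le {w : HeightOneSpectrum (𝓞 K)} (hw : (p : 𝓞 K) ∈ w.asIdeal)
    {x : w.adicCompletion K} (hx1 : Valued.v x ≤ 1) {b : ℕ} (hb : 1 ≤ b)
    (hx : Valued.v (x - 1) ≤ (WithZero.exp (-(b : ℤ)) : WithZero (Multiplicative ℤ))) :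
    Valued.v (x ^ p - 1) ≤ (WithZero.exp (-((b + 1 : ℕ) : ℤ)) : WithZero (Multiplicative ℤ)) := by
  have hgeom1 : ∀ i : ℕ, Valued.v (∑ j ∈ Finset.range i, x ^ j) ≤ 1 := fun i =>
    Valuation.map_sum_le _ fun j _ => by rw [map_pow]; exact pow_le_one' hx1 j
  -- `|x^i - 1| ≤ |ϖ|^b`
  have hpow : ∀ i : ℕ, Valued.v (x ^ i - 1) ≤ (WithZero.exp (-(b : ℤ)) : WithZero (Multiplicative ℤ)) := fun i => by
    rw [← mul_geom_sum x i, map_mul]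
    exact (mul_le_mul' hx (hgeom1 i)).trans_eq (mul_one _)
  -- the second factor has valuation `≤ |ϖ|`
  have hb1 : (WithZero.exp (-(b : ℤ)) : WithZero (Multiplicative ℤ)) ≤ WithZero.exp (-(1 : ℤ)) :=
    WithZero.exp_le_exp.2 (by omega)
  have hsum : Valued.v (∑ i ∈ Finset.range p, x ^ i) ≤ (WithZero.exp (-(1 : ℤ)) : WithZero (Multiplicative ℤ)) := by
    have heq : (∑ i ∈ Finset.range p, x ^ i) = (∑ i ∈ Finset.range p, (x ^ i - 1)) + (p : ℕ) := by
      rw [Finset.sum_sub_distrib, Finset.sum_const, Finset.card_range, nsmul_eq_mul, mul_one, sub_add_cancel]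
    rw [heq]
    refine Valuation.map_add_le _ (Valuation.map_sum_le _ fun i _ => (hpow i).trans hb1) (valued_natCast_prime_le hw)
  rw [← mul_geom_sum x p, map_mul, Nat.cast_add, Nat.cast_one, neg_add, WithZero.exp_add]
  exact mul_le_mul' hx hsum

/-- **`u ∈ T_w(b)`, `b ≥ 1`, `w ∣ p` `⇒ u^p ∈ T_w(b+1)`.** [folklore] -/
theorem pow_prime_mem_torusBall {n : ℕ} {w : HeightOneSpectrum (𝓞 K)} (hw : (p : 𝓞 K) ∈ w.asIdeal) {b : ℕ} (hb : 1 ≤ b)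
    {u : Fin n → (w.adicCompletionIntegers K)ˣ} (hu : u ∈ torusBall w b) : u ^ p ∈ torusBall w (b + 1) := by
  rw [mem_torusBall_iff] at hu ⊢
  intro j
  rw [Pi.pow_apply, Units.val_pow_eq_pow_val, SubmonoidClass.coe_pow]
  exact valued_pow_prime_sub_one_le hw (valued_coe_units_adicCompletionIntegers w (u j)).le hb (hu j)

/-- **`u ∈ T_w(b)`, `b ≥ 1`, `w ∣ p` `⇒ u^{p^a} ∈ T_w(b + a)`.** [folklore] -/
theorem pow_prime_pow_mem_torusBall {n : ℕ} {w : HeightOneSpectrum (𝓞 K)} (hw : (p : 𝓞 K) ∈ w.asIdeal) {b : ℕ}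
    (hb : 1 ≤ b) {u : Fin n → (w.adicCompletionIntegers K)ˣ} (hu : u ∈ torusBall w b) (a : ℕ) :
    u ^ p ^ a ∈ torusBall w (b + a) := by
  induction a with
  | zero => rwa [pow_zero, pow_one, add_zero]
  | succ a ih =>
    rw [pow_succ, pow_mul, ← add_assoc]
    exact pow_prime_mem_torusBall hw (by omega) ih

namespace TameLevel

open IntegralWeightGL2 LevelAction ParallelWeight PolyAction

variable [Fact p.Prime] (𝒰 : TameLevel 2 K p) (O : Type) [CommRing O] {E : Type} [Field E] [CharZero E] (lv : ℕ → ℕ)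
  {v : (K →+* E) → HeightOneSpectrum (𝓞 K)}

/-! ### `⟨d⟩` has `p`-power order on the engine cohomology -/

/-- **`⟨d⟩^{p^a} = 1` on `H^j(X_{U(lv n)}, O/pⁿ)`** for a torus datum `d` of depth `c₀ ≥ 1` with
`lv n ≤ c₀ + a`. [cite: KhareThorne2017, §6.3] -/
theorem engHecke_torusElement_pow_eq_one (h𝒰 : 𝒰.IsMaximalAbove) {c₀ : ℕ} (hc₀ : 1 ≤ c₀) (n j : ℕ)
    (d : TorusDatum K p c₀) {a : ℕ} (ha : lv n ≤ c₀ + a) :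
    𝒰.engHecke O lv n j d.torusElement ^ p ^ a = 1 := by
  rw [𝒰.engHecke_torusElement h𝒰 n j d, ← map_pow]
  refine 𝒰.levelTorus_eq_one_of_mem h𝒰 _ _ _ _ _ _ fun w => ?_
  rw [Pi.pow_apply]
  exact torusBall_antitone w.1 ha (pow_prime_pow_mem_torusBall w.2 hc₀ (d.units_mem_torusBall w) a)

/-! ### The weight ideal acts nilpotently on the twisted level modules -/

variable [h𝒰 : Fact 𝒰.IsMaximalAbove] {k c₀ : ℕ}

/-- `C r` acts on the twisted level module as the scalar `r mod pⁿ`. [folklore] -/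
theorem C_twSmul (n j : ℕ) (r : O) (m : 𝒰.EngModTw O lv k c₀ n j) :
    (C r : MvPolynomial (𝒰.Syms c₀) O) • m =
      EngModTw.ofEngMod 𝒰 O lv k c₀ ((Ideal.Quotient.mk (Ideal.span {((p : O)) ^ n}) r) • m.toEngMod) := by
  change EngModTw.ofEngMod 𝒰 O lv k c₀ ((C r : MvPolynomial (𝒰.Syms c₀) O) • m).toEngMod = _
  rw [twSmul_def, symTwist_C, engSmul_def]
  congr 1
  exact polyHom_C_apply _ r _

/-- `(C p)^n` kills the twisted level module `E_n(j)` (an `O/pⁿ`-module). [folklore] -/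
theorem C_pow_twSmul_eq_zero (n j : ℕ) (m : 𝒰.EngModTw O lv k c₀ n j) :
    ((C (p : O) : MvPolynomial (𝒰.Syms c₀) O) ^ n) • m = 0 := by
  rw [← map_pow, C_twSmul]
  have h0 : (Ideal.Quotient.mk (Ideal.span {((p : O)) ^ n}) ((p : O) ^ n)) = 0 :=
    Ideal.Quotient.eq_zero_iff_mem.2 (Ideal.mem_span_singleton_self _)
  rw [h0, zero_smul]
  rfl

/-- **With trivial weight constants, `X_d` acts on the twisted level module as `⟨d⟩`** (on the ambient
cohomology). [folklore] -/
theorem coe_X_inr_twSmul (hN1 : ∀ d : TorusDatum K p c₀, (((Algebra.norm ℤ d.2.u : ℤ)) : O) ^ (k - 2) = 1)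
    (n j : ℕ) (d : TorusDatum K p c₀) (m : 𝒰.EngModTw O lv k c₀ n j) :
    (((X (Sum.inr d) : MvPolynomial (𝒰.Syms c₀) O) • m).toEngMod : 𝒰.engCohomology O lv n j) =
      𝒰.engHecke O lv n j d.torusElement (m.toEngMod : 𝒰.engCohomology O lv n j) := by
  rw [coe_twSmul, symTwist_X_inr, hN1 d, C_1, one_mul]
  change polyHom (Ideal.Quotient.mk _) (𝒰.engFamily O c₀ lv n j) (𝒰.engFamily_comm n j) (X (Sum.inr d)) _ = _
  rw [polyHom_X, engFamily_inr]

/-- With trivial weight constants, `X_d^N` acts as `⟨d⟩^N`. [folklore] -/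
theorem coe_X_inr_pow_twSmul (hN1 : ∀ d : TorusDatum K p c₀, (((Algebra.norm ℤ d.2.u : ℤ)) : O) ^ (k - 2) = 1)
    (n j : ℕ) (d : TorusDatum K p c₀) (N : ℕ) (m : 𝒰.EngModTw O lv k c₀ n j) :
    ((((X (Sum.inr d) : MvPolynomial (𝒰.Syms c₀) O) ^ N) • m).toEngMod : 𝒰.engCohomology O lv n j) =
      (𝒰.engHecke O lv n j d.torusElement ^ N) (m.toEngMod : 𝒰.engCohomology O lv n j) := by
  induction N generalizing m with
  | zero => rw [pow_zero, pow_zero, one_smul, Module.End.one_apply]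
  | succ N ih =>
    rw [pow_succ, mul_smul, ih, 𝒰.coe_X_inr_twSmul O lv hN1 n j d m, pow_succ, Module.End.mul_apply]

/-- **With trivial weight constants, `X_d^{p^a} − 1` kills the twisted level module** when `d` has depth
`c₀ ≥ 1` and `lv n ≤ c₀ + a`. [cite: KhareThorne2017, §6.3] -/
theorem X_inr_pow_sub_one_twSmul_eq_zero (hN1 : ∀ d : TorusDatum K p c₀, (((Algebra.norm ℤ d.2.u : ℤ)) : O) ^ (k - 2) = 1)
    (hc₀ : 1 ≤ c₀) (n j : ℕ) (d : TorusDatum K p c₀) {a : ℕ} (ha : lv n ≤ c₀ + a) (m : 𝒰.EngModTw O lv k c₀ n j) :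
    (((X (Sum.inr d) : MvPolynomial (𝒰.Syms c₀) O) ^ p ^ a) - 1) • m = 0 := by
  rw [sub_smul, one_smul, sub_eq_zero]
  refine EngMod.ext 𝒰 ?_
  change ((((X (Sum.inr d) : MvPolynomial (𝒰.Syms c₀) O) ^ p ^ a) • m).toEngMod : 𝒰.engCohomology O lv n j) =
    (m.toEngMod : 𝒰.engCohomology O lv n j)
  rw [𝒰.coe_X_inr_pow_twSmul O lv hN1 n j d (p ^ a) m, 𝒰.engHecke_torusElement_pow_eq_one O lv h𝒰.out hc₀ n j d ha,
    Module.End.one_apply]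

/-- **The weight family** `(p, X_{d_1} − 1, …, X_{d_m} − 1)` of a finite family of torus data (the shape
used by the dual-annihilator lemmas). [cite: KhareThorne2017, §6.5] -/
def weightFamily (O : Type) [CommRing O] {m : ℕ} (ds : Fin m → TorusDatum K p c₀) :
    Fin (m + 1) → MvPolynomial (𝒰.Syms c₀) O :=
  Fin.cons (C (p : O)) fun i => X (Sum.inr (ds i)) - 1

omit h𝒰 in
/-- `weightFamily 0 = C p`. [folklore] -/
@[simp]
theorem weightFamily_zero {m : ℕ} (ds : Fin m → TorusDatum K p c₀) : 𝒰.weightFamily O ds 0 = C (p : O) :=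
  rfl

omit h𝒰 in
/-- `weightFamily (i+1) = X_{d_i} − 1`. [folklore] -/
@[simp]
theorem weightFamily_succ {m : ℕ} (ds : Fin m → TorusDatum K p c₀) (i : Fin m) :
    𝒰.weightFamily O ds i.succ = X (Sum.inr (ds i)) - 1 :=
  rfl

/-- **Some power of the weight ideal `J = (p, X_{d_i} − 1)` kills the twisted level module `E_n(j)`**
(torus data of depth `c₀ ≥ 1`, trivial weight constants). [cite: Hida1994AIF, §3, proof of Thm 3.2]
[cite: KhareThorne2017, §6.5, Lemma 6.17] -/
theorem exists_pow_weightIdeal_smul_top_eq_bot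
    (hN1 : ∀ d : TorusDatum K p c₀, (((Algebra.norm ℤ d.2.u : ℤ)) : O) ^ (k - 2) = 1) (hc₀ : 1 ≤ c₀)
    (n j : ℕ) {m : ℕ} (ds : Fin m → TorusDatum K p c₀) :
    ∃ L : ℕ, Ideal.span (Set.range (𝒰.weightFamily O ds)) ^ L • (⊤ : Submodule (MvPolynomial (𝒰.Syms c₀) O)
      (𝒰.EngModTw O lv k c₀ n j)) = ⊥ := by
  have hp : p.Prime := Fact.out
  refine exists_pow_smul_top_eq_bot_of_le_radical _ (Submodule.fg_span (Set.finite_range _)) (Ideal.span_le.2 ?_)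
  -- `C p` is in the radical of the annihilator
  have hCp : (C (p : O) : MvPolynomial (𝒰.Syms c₀) O) ∈
      ((⊤ : Submodule (MvPolynomial (𝒰.Syms c₀) O) (𝒰.EngModTw O lv k c₀ n j)).annihilator).radical :=
    ⟨n, (mem_annihilator_top_iff _).2 fun m' => 𝒰.C_pow_twSmul_eq_zero O lv n j m'⟩
  rintro _ ⟨i, rfl⟩
  refine Fin.cases ?_ (fun i => ?_) i
  · exact hCp
  · rw [weightFamily_succ]
    refine sub_one_mem_radical_of_pow_sub_one_mem hp _ (by rwa [← map_natCast (C : O →+* MvPolynomial (𝒰.Syms c₀) O) p])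
      (a := lv n) ?_
    exact Ideal.le_radical ((mem_annihilator_top_iff _).2 fun m' =>
      𝒰.X_inr_pow_sub_one_twSmul_eq_zero O lv hN1 hc₀ n j (ds i) (a := lv n) (Nat.le_add_left _ _) m')

/-- The same power kills the character module of `E_n(j)`. [folklore] -/
theorem exists_pow_weightIdeal_smul_top_characterModule_eq_bot
    (hN1 : ∀ d : TorusDatum K p c₀, (((Algebra.norm ℤ d.2.u : ℤ)) : O) ^ (k - 2) = 1) (hc₀ : 1 ≤ c₀)
    (n j : ℕ) {m : ℕ} (ds : Fin m → TorusDatum K p c₀) :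
    ∃ L : ℕ, Ideal.span (Set.range (𝒰.weightFamily O ds)) ^ L • (⊤ : Submodule (MvPolynomial (𝒰.Syms c₀) O)
      (CharacterModule (𝒰.EngModTw O lv k c₀ n j))) = ⊥ := by
  obtain ⟨L, hL⟩ := 𝒰.exists_pow_weightIdeal_smul_top_eq_bot O lv hN1 hc₀ n j ds
  exact ⟨L, smul_top_characterModule_eq_bot _ hL⟩

end TameLevel

end BigHeckeGLn

end Literature.NumberTheory.Automorphic
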